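import Summits.BirchSwinnertonDyer.BirchSwinnertonDyer.Theorems.AdditiveKolyvaginRoadKolyvaginJumpAdapter
import Summits.BirchSwinnertonDyer.BirchSwinnertonDyer.Theorems.AdditiveKolyvaginRoadToricCount
import Summits.BirchSwinnertonDyer.BirchSwinnertonDyer.Theorems.AdditiveKolyvaginRoadToricLagrangianIso
import Summits.BirchSwinnertonDyer.BirchSwinnertonDyer.Theorems.KolyvaginRoadThreeMethod2IsoLocalDuality
import Summits.BirchSwinnertonDyer.Rank1Residual.X11b.KummerRelaxedStructures
import Summits.BirchSwinnertonDyer.Rank1Residual.X11b.KummerPoitouTateExact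
import Summits.BirchSwinnertonDyer.Rank1Residual.X11b.KummerStructureDuality
import Summits.BirchSwinnertonDyer.Rank1Residual.X10.WeilCupSymmetric
import Summits.BirchSwinnertonDyer.Rank1Residual.X10.ResidualSelmerReciprocity
import Summits.BirchSwinnertonDyer.Rank1Residual.GaloisImage.LocalEulerPoincareCharacteristicHolds
import HarnessLib

/-!
# Route `AdditiveKolyvaginRoad`, crux `KolyvaginPrimitiveAdditive` (item stmt-BirchSwinnertonDyer-21400), stub J2
# (`stub_twoPrimeJumpAdditive`, skeleton v10): the `{v₁, v₂}`-RELAXED KUMMER SELMER GROUP HAS LAGRANGIAN IMAGE in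
# `H¹(K_{v₁}, E[p]) ⊕ H¹(K_{v₂}, E[p])`, and the local hyperbolic planes at Bertolini–Darmon admissible primes
# (cell `pub/bsd-wall`, lead prover `bsd-wall-akr-p1` g5; `--supports stmt-BirchSwinnertonDyer-21400`, helper)

WHAT (Poitou–Tate model currency; `E = W/K`, `b_v = inv_v(· ∪ₑ ·)` for a Poitou–Tate family `inv` and a Weil pairing `e`):
§1 `natCard_mul_self_eq_of_lagrangian_prod` — abstract: a subgroup `Λ ≤ V₁ × V₂` which is its own annihilator for an
orthogonal sum `b₁ ⊕ b₂` of perfect `ℤ/n`-valued pairings has `#Λ² = #V₁ · #V₂`. §2 the local plane at the place `v`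
of an admissible `q`: `#H¹(K_v, E[p]) = p²`, `b_v` SYMMETRIC (Klagsbrun–Mazur–Rubin Thm. 3.1 (i), X10
`weilCupLocal_symm`) with trivial right kernel, the Kummer condition `F_v` and the toric condition `T_v` isotropic of
order `p` (Lagrangian + count). §3 for finite places `v₁ ≠ v₂` the image `Λ` of `kummerOutside E p {v₁, v₂}` (Kummer at
every place except `v₁, v₂`, nothing there) under `(loc_{v₁}, loc_{v₂})` is isotropic AND maximal for `b₁ ⊕ b₂`
(X11b's `sum_invWeilPairing_localization_eq_zero_of_mem_kummerOutside` and `exists_mem_kummerOutside_localization_eq`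
= Howard Thm. 2.1.11 ∕ Milne I 4.10 for `kummerStrict ≤ kummerRelaxed`), hence of order `p²` at two admissible places.

HONEST FRAMING: theorems only; 0 definitions, 0 named facts, 0 `sorry`; §3 is CONDITIONAL on the properties
`IsPerfect`, `SumLocalTermEqZero`, `SelmerComplement` of `inv` (the content of the named fact
`poitouTate_selmerStructure_duality`); closes nothing.

References: [cite: WZhang2014, Lemma 5.3, Prop. 5.4] [cite: MilneADT2006, Ch. I, Cor. 2.3, Thm. 2.8, Thm. 4.10]
[cite: Howard2004HeegnerKolyvagin, Thm. 2.1.11] [cite: KlagsbrunMazurRubin2013, Thm. 3.1 (i)] [cite: BertoliniDarmon2005,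
Lemma 2.6, §2.2–§2.3] [cite: PoonenRains2012, Prop. 4.10].
-/

-- single-conjunct summit: `Summit.BirchSwinnertonDyer.BirchSwinnertonDyer.…` repeats the name by design
set_option linter.dupNamespace false

noncomputable section

open scoped Classical NumberField
open Function NumberField IsDedekindDomain Field WeierstrassCurve
open Literature.NumberTheory.EllipticCurves Literature.NumberTheory.EllipticCurves.ModularForms
open Literature.NumberTheory.GaloisRepresentations Literature.NumberTheory.GaloisRepresentations.DiscreteGaloisModule
  Literature.NumberTheory.GaloisCohomology
open Summit.BirchSwinnertonDyer.Rank1Residual.X11b.FiniteDuality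
open Summit.BirchSwinnertonDyer.Rank1Residual.X11b.Relaxation
open Summit.BirchSwinnertonDyer.Rank1Residual.X11b
open Summit.BirchSwinnertonDyer.Rank1Residual.GaloisImage
open Summit.BirchSwinnertonDyer.Rank1Residual.X11b.Three.Koly.Method2

namespace Summit.BirchSwinnertonDyer.BirchSwinnertonDyer.Theorems.AdditiveKoly

/-! ## §1 A Lagrangian for an orthogonal sum of two perfect pairings has `#Λ² = #V₁ · #V₂` -/

section Abstract

variable {V₁ V₂ : Type*} [AddCommGroup V₁] [AddCommGroup V₂] {n : ℕ} [NeZero n]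

/-- **`#Λ² = #V₁ · #V₂` for a LAGRANGIAN of `b₁ ⊕ b₂`** (`V_i` finite killed by `n`, `b_i` with injective right
adjoints, `Λ` isotropic and containing every right-orthogonal `t`): `Λ` is its own right annihilator under `B = b₁ ⊕ b₂`,
whose right adjoint is bijective (injective coordinatewise + counting), so `#Λ · #Λ = #(V₁ × V₂)` (X11b
`natCard_annRight_mul`). [cite: MilneADT2006, Ch. I, Cor. 2.3] -/
theorem natCard_mul_self_eq_of_lagrangian_prod [Finite V₁] [Finite V₂]
    (hV₁ : ∀ v : V₁, n • v = 0) (hV₂ : ∀ v : V₂, n • v = 0)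
    (b₁ : V₁ →+ V₁ →+ ZMod n) (b₂ : V₂ →+ V₂ →+ ZMod n)
    (hb₁ : Injective b₁.flip) (hb₂ : Injective b₂.flip)
    (Λ : AddSubgroup (V₁ × V₂)) (hiso : ∀ l ∈ Λ, ∀ l' ∈ Λ, b₁ l.1 l'.1 + b₂ l.2 l'.2 = 0)
    (hmax : ∀ t : V₁ × V₂, (∀ l ∈ Λ, b₁ l.1 t.1 + b₂ l.2 t.2 = 0) → t ∈ Λ) :
    Nat.card Λ * Nat.card Λ = Nat.card V₁ * Nat.card V₂ := by
  -- the orthogonal sum `B`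
  let B : (V₁ × V₂) →+ (V₁ × V₂) →+ ZMod n :=
    ((b₁.compl₂ (AddMonoidHom.fst V₁ V₂)).comp (AddMonoidHom.fst V₁ V₂)) +
      ((b₂.compl₂ (AddMonoidHom.snd V₁ V₂)).comp (AddMonoidHom.snd V₁ V₂))
  have hB : ∀ l t : V₁ × V₂, B l t = b₁ l.1 t.1 + b₂ l.2 t.2 := fun l t ↦ rfl
  have hA : ∀ x : V₁ × V₂, n • x = 0 := fun x ↦ Prod.ext (hV₁ x.1) (hV₂ x.2)
  -- `Λ` is its own right annihilator
  have hann : annRight B Λ = Λ := by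
    ext t
    rw [mem_annRight_iff]
    constructor
    · intro h
      exact hmax t fun l hl ↦ by rw [← hB]; exact h l hl
    · intro ht l hl
      rw [hB]
      exact hiso l hl t ht
  -- the right adjoint of `B` is injective, hence bijective by counting
  have hinj : Injective B.flip := by
    intro t t' h
    rw [← sub_eq_zero]
    set d := t - t' with hd
    have hd0 : ∀ l, B l d = 0 := fun l ↦ by
      have := DFunLike.congr_fun h l
      rw [AddMonoidHom.flip_apply, AddMonoidHom.flip_apply] at this
      rw [hd, map_sub, this, sub_self]
    have h1 : d.1 = 0 := hb₁ (by ext a; have := hd0 (a, 0); rw [hB] at this; simpa using this)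
    have h2 : d.2 = 0 := hb₂ (by ext a; have := hd0 (0, a); rw [hB] at this; simpa using this)
    exact Prod.ext h1 h2
  haveI := finite_addMonoidHom_zmod (V₁ × V₂) n
  have hflip : Bijective B.flip := hinj.bijective_of_nat_card_le (Nat.card_addMonoidHom_zmod hA).le
  have h := natCard_annRight_mul hA B hflip Λ
  rw [hann, Nat.card_prod] at h
  exact h

end Abstract

/-! ## §2 The local plane at a Bertolini–Darmon admissible prime -/

section Local

variable (W : WeierstrassCurve ℚ) (K : Type) [Field K] [NumberField K] (p : ℕ) [W.IsElliptic]
variable (e : geomTorsion (W.baseChange K) ((p ^ 1 : ℕ) : ℤ) → geomTorsion (W.baseChange K) ((p ^ 1 : ℕ) : ℤ) →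
    AlgebraicClosure K)
  (hμ : ∀ P Q, e P Q ^ (p ^ 1) = 1) (hadd₁ : ∀ P₁ P₂ Q, e (P₁ + P₂) Q = e P₁ Q * e P₂ Q)
  (hadd₂ : ∀ P Q₁ Q₂, e P (Q₁ + Q₂) = e P Q₁ * e P Q₂) (halt : ∀ Q, e Q Q = 1)
  (hnondeg : ∀ Q, (∀ P, e P Q = 1) → Q = 0)
  (hgal : ∀ (σ : absoluteGaloisGroup K) (P Q : geomTorsion (W.baseChange K) ((p ^ 1 : ℕ) : ℤ)),
    σ • e P Q = e (σ • P) (σ • Q))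
  (inv : LocalInvariants K (p ^ 1))

/-- **`#H¹(K_v, E[p]) = p²` at the place of a Bertolini–Darmon admissible prime** (`[K : ℚ] = 2`): `≤ p²` by
(H0)_p (`natCard_invariants_le_of_admQ`) and the prime-to-`p` Euler characteristic, `≥ p²` by akr-p1 g4's
`sq_le_natCard_galoisCohomology_one_of_admQ`. [cite: BertoliniDarmon2005, §2.2–§2.3] [cite: MilneADT2006, Ch. I, Thm. 2.8] -/
theorem natCard_localH1_eq_sq_of_admQ [W.IsGloballyMinimal] [Fact p.Prime] (hK2 : Module.finrank ℚ K = 2)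
    (q : AdmQ W K p)
    (v : HeightOneSpectrum (𝓞 K)) (hqv : ((q : ℕ) : 𝓞 K) ∈ v.asIdeal) :
    Nat.card (galoisCohomology (((W.baseChange K).torsionGaloisModule ((p ^ 1 : ℕ) : ℤ)).toLocal (Sum.inr v)) 1) =
      p ^ 2 := by
  have hp : p.Prime := Fact.out
  haveI : Fact (Nat.Prime (p ^ 1)) := ⟨by rw [pow_one]; exact hp⟩
  refine le_antisymm ?_ (sq_le_natCard_galoisCohomology_one_of_admQ W K p hK2 q v hqv)
  have hpv : ((p ^ 1 : ℕ) : 𝓞 K) ∉ v.asIdeal := by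
    have h := (hasGoodReductionAt_of_isAdmissiblePrime W K q.2 v hqv).2
    rw [Int.cast_natCast] at h
    rw [Nat.pow_one]
    exact h
  have h := Iso.natCard_galoisCohomology_one_torsion_le_sq (W.baseChange K) (p ^ 1) v hpv
    (natCard_invariants_le_of_admQ W K p hK2 q v hqv)
  exact h.trans (le_of_eq (by rw [pow_one]))

omit [W.IsElliptic] in
include halt in
/-- **The local Weil–Tate pairing `b_v = inv_v(· ∪ₑ ·)` is SYMMETRIC** (Klagsbrun–Mazur–Rubin Thm. 3.1 (i); X10
`weilCupLocal_symm`, skewness of `e` from `e(Q, Q) = 1`). [cite: KlagsbrunMazurRubin2013, Thm. 3.1 (i)] -/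
theorem invWeilPairing_symm_P [Fact p.Prime] [NeZero (p ^ 1 : ℕ)]
    [∀ v : Place K, CompactSpace (absoluteGaloisGroup (Place.Completion v))]
    [Finite (geomTorsion (W.baseChange K) ((p ^ 1 : ℕ) : ℤ))] (v : Place K)
    (a a' : galoisCohomology (((W.baseChange K).torsionGaloisModule ((p ^ 1 : ℕ) : ℤ)).toLocal v) 1) :
    invWeilPairing (W.baseChange K) (p ^ 1) e hμ hadd₁ hadd₂ hgal inv v a a' =
      invWeilPairing (W.baseChange K) (p ^ 1) e hμ hadd₁ hadd₂ hgal inv v a' a := by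
  haveI : Fact (Nat.Prime (p ^ 1)) := ⟨by rw [pow_one]; exact Fact.out⟩
  have hskew := Summit.BirchSwinnertonDyer.Rank1Residual.X10.ResidualSelmerReciprocity.skew_of_alt (W.baseChange K)
    (p ^ 1) e hμ hadd₁ hadd₂ halt
  rw [invWeilPairing_apply, invWeilPairing_apply,
    Summit.BirchSwinnertonDyer.Rank1Residual.X10.WeilCupSymmetric.weilCupLocal_symm (W.baseChange K) (p ^ 1) e hμ
      hadd₁ hadd₂ hgal hskew v a a']

include hnondeg in
/-- **Trivial right kernel**: `b_v(·, a) = 0 ⟹ a = 0` at a finite place with `inv_v` injective (local Tate duality for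
`E[p]`, X11b `invWeilPairing_flip_bijective`). [cite: MilneADT2006, Ch. I, Cor. 2.3] -/
theorem invWeilPairing_right_nondegenerate_P [NeZero (p ^ 1 : ℕ)] (v : HeightOneSpectrum (𝓞 K))
    (hinv : Injective (inv (Sum.inr v)))
    (a : galoisCohomology (((W.baseChange K).torsionGaloisModule ((p ^ 1 : ℕ) : ℤ)).toLocal (Sum.inr v)) 1)
    (ha : ∀ a', invWeilPairing (W.baseChange K) (p ^ 1) e hμ hadd₁ hadd₂ hgal inv (Sum.inr v) a' a = 0) : a = 0 := by
  have hbij := KummerPT.invWeilPairing_flip_bijective (W.baseChange K) (p ^ 1) e hμ hadd₁ hadd₂ hgal hnondeg inv v hinv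
  have h : (invWeilPairing (W.baseChange K) (p ^ 1) e hμ hadd₁ hadd₂ hgal inv (Sum.inr v)).flip a =
      (invWeilPairing (W.baseChange K) (p ^ 1) e hμ hadd₁ hadd₂ hgal inv (Sum.inr v)).flip 0 := by
    ext a'
    rw [AddMonoidHom.flip_apply, AddMonoidHom.flip_apply, map_zero, ha a']
  exact hbij.1 h

include hnondeg in
/-- **A Lagrangian local condition has order `#H¹(K_v, E[p])^{1/2}`**: `#L · #L = #H¹(K_v, E[p])` for
`annRight b_v L = L` (X11b `natCard_annRight_mul` with the bijective right adjoint). [cite: MilneADT2006, Ch. I, Cor. 2.3] -/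
theorem natCard_mul_self_eq_of_annRight_eq [NeZero (p ^ 1 : ℕ)] (v : HeightOneSpectrum (𝓞 K))
    (hinv : Injective (inv (Sum.inr v)))
    (L : AddSubgroup (galoisCohomology (((W.baseChange K).torsionGaloisModule ((p ^ 1 : ℕ) : ℤ)).toLocal
      (Sum.inr v)) 1))
    (hL : annRight (invWeilPairing (W.baseChange K) (p ^ 1) e hμ hadd₁ hadd₂ hgal inv (Sum.inr v)) L = L) :
    Nat.card L * Nat.card L =
      Nat.card (galoisCohomology (((W.baseChange K).torsionGaloisModule ((p ^ 1 : ℕ) : ℤ)).toLocal (Sum.inr v)) 1) := by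
  haveI := KummerPT.finite_galoisCohomology_toLocal_inr (W.baseChange K) (p ^ 1) v
  have h := natCard_annRight_mul (KummerPT.nsmul_galoisCohomology_toLocal_eq_zero (W.baseChange K) (p ^ 1) (Sum.inr v))
    (invWeilPairing (W.baseChange K) (p ^ 1) e hμ hadd₁ hadd₂ hgal inv (Sum.inr v))
    (KummerPT.invWeilPairing_flip_bijective (W.baseChange K) (p ^ 1) e hμ hadd₁ hadd₂ hgal hnondeg inv v hinv) L
  rwa [hL] at h

include halt hnondeg in
/-- **The Kummer condition is Lagrangian at every place** of the imaginary quadratic `K` (X11b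
`annRight_invWeilPairing_kummerSelmerStructure_eq` with the PROVED local Euler–Poincaré characteristic).
[cite: MilneADT2006, Ch. I, Cor. 3.4, Thm. 2.8] [cite: PoonenRains2012, Prop. 4.10] -/
theorem annRight_kummer_eq_P [Fact p.Prime] (hK : IsImaginaryQuadratic K) (hperf : inv.IsPerfect) (v : Place K) :
    annRight (invWeilPairing (W.baseChange K) (p ^ 1) e hμ hadd₁ hadd₂ hgal inv v)
      ((W.baseChange K).kummerSelmerStructure ((p ^ 1 : ℕ) : ℤ) v) =
      (W.baseChange K).kummerSelmerStructure ((p ^ 1 : ℕ) : ℤ) v := by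
  have hp : p.Prime := Fact.out
  haveI : NeZero (p ^ 1 : ℕ) := ⟨pow_ne_zero 1 hp.ne_zero⟩
  have hp1 : IsPrimePow (p ^ 1 : ℕ) := hp.isPrimePow.pow one_ne_zero
  have hEP : ∀ v : HeightOneSpectrum (𝓞 K), localEulerPoincareCharacteristic (v.adicCompletion K) := fun v ↦ by
    haveI : CharZero (v.adicCompletion K) := charZero_of_injective_algebraMap (algebraMap K _).injective
    exact localEulerPoincareCharacteristic_holds (v.adicCompletion K)
  exact KummerDuality.annRight_invWeilPairing_kummerSelmerStructure_eq (W.baseChange K) (p ^ 1) e hμ hadd₁ hadd₂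
    hgal halt hnondeg inv (fun w ↦ hK.2.isComplex w) hp1 hperf hEP v

/-- **`#F_v = p`**: the Kummer condition at the place of an admissible prime has `p` elements (Lagrangian of the plane
of order `p²`; a Weil pairing and a perfect Poitou–Tate family exist by the tree's PROVED `exists_weilPairing_holds` and
`poitouTate_sum_localTatePairing_eq_zero_of_isTotallyComplex`). [cite: BertoliniDarmon2005, Lemma 2.6 (dim H¹_fin = 1)] -/
theorem natCard_kummer_eq_of_admQ [W.IsGloballyMinimal] [Fact p.Prime] (hK : IsImaginaryQuadratic K)
    (q : AdmQ W K p) (v : HeightOneSpectrum (𝓞 K)) (hqv : ((q : ℕ) : 𝓞 K) ∈ v.asIdeal) :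
    Nat.card ((W.baseChange K).kummerSelmerStructure ((p ^ 1 : ℕ) : ℤ) (Sum.inr v)) = p := by
  have hp : p.Prime := Fact.out
  haveI : NeZero (p ^ 1 : ℕ) := ⟨pow_ne_zero 1 hp.ne_zero⟩
  haveI : IsTotallyComplex K := hK.2
  haveI : Finite (geomTorsion (W.baseChange K) ((p ^ 1 : ℕ) : ℤ)) := finite_geomTorsion_of_neZero (W.baseChange K) (p ^ 1)
  obtain ⟨e, hμ, hadd₁, hadd₂, halt, hnondeg, hgal⟩ :=
    exists_weilPairing_holds (W.baseChange K) (p ^ 1) (by rw [pow_one]; exact hp.two_le) (by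
      exact_mod_cast pow_ne_zero 1 hp.ne_zero)
  obtain ⟨inv, hperf, -⟩ := poitouTate_sum_localTatePairing_eq_zero_of_isTotallyComplex K (p ^ 1)
  have h := natCard_mul_self_eq_of_annRight_eq W K p e hμ hadd₁ hadd₂ hnondeg hgal inv v (hperf v).1.1 _
    (annRight_kummer_eq_P W K p e hμ hadd₁ hadd₂ halt hnondeg hgal inv hK hperf (Sum.inr v))
  rw [natCard_localH1_eq_sq_of_admQ W K p hK.1 q v hqv, sq] at h
  exact Nat.mul_self_inj.mp h

include halt in
/-- **The Kummer condition is isotropic for `b_v`** (Poonen–Rains; X11b `invWeilPairing_eq_zero_of_mem`).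
[cite: PoonenRains2012, Prop. 4.10] -/
theorem kummer_isotropic_P [NeZero (p ^ 1 : ℕ)] (v : Place K) :
    ∀ a ∈ (W.baseChange K).kummerSelmerStructure ((p ^ 1 : ℕ) : ℤ) v,
      ∀ a' ∈ (W.baseChange K).kummerSelmerStructure ((p ^ 1 : ℕ) : ℤ) v,
        invWeilPairing (W.baseChange K) (p ^ 1) e hμ hadd₁ hadd₂ hgal inv v a a' = 0 :=
  fun _ ha _ ha' ↦ invWeilPairing_eq_zero_of_mem (W.baseChange K) (p ^ 1) e hμ hadd₁ hadd₂ hgal halt inv v ha ha'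

include halt in
/-- **The toric condition is isotropic for `b_v`** at the place of an admissible prime (akr-p1 g3
`htorIso_toricLocalCondition`). [cite: BertoliniDarmon2005, §2.2–§2.3] [cite: WZhang2014, Prop. 5.4] -/
theorem toric_isotropic_P [W.IsGloballyMinimal] [Fact p.Prime]
    [∀ v : Place K, CompactSpace (absoluteGaloisGroup (Place.Completion v))]
    [Finite (geomTorsion (W.baseChange K) ((p ^ 1 : ℕ) : ℤ))]
    (hK2 : Module.finrank ℚ K = 2) (q : AdmQ W K p) (v : HeightOneSpectrum (𝓞 K))
    (hqv : ((q : ℕ) : 𝓞 K) ∈ v.asIdeal) :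
    ∀ a ∈ toricLocalCondition (W.baseChange K) (v.adicCompletion K) ((p ^ 1 : ℕ) : ℤ),
      ∀ a' ∈ toricLocalCondition (W.baseChange K) (v.adicCompletion K) ((p ^ 1 : ℕ) : ℤ),
        invWeilPairing (W.baseChange K) (p ^ 1) e hμ hadd₁ hadd₂ hgal inv (Sum.inr v) a a' = 0 := by
  intro a ha a' ha'
  rw [invWeilPairing_apply, htorIso_toricLocalCondition W K p hK2 q v hqv e hμ hadd₁ hadd₂ halt hgal a ha a' ha']
  exact map_zero _

/-- **`#T_v = p`**: the toric condition at the place of an admissible prime has `p` elements (isotropic +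
`#H¹ ≤ #T · #T` ⟹ Lagrangian, akr-p1 g4; then the plane has order `p²`). [cite: BertoliniDarmon2005, §2.3 (dim H¹_ord = 1)] -/
theorem natCard_toric_eq_of_admQ [W.IsGloballyMinimal] [Fact p.Prime]
    [∀ v : Place K, CompactSpace (absoluteGaloisGroup (Place.Completion v))]
    (hK : IsImaginaryQuadratic K) (q : AdmQ W K p) (v : HeightOneSpectrum (𝓞 K)) (hqv : ((q : ℕ) : 𝓞 K) ∈ v.asIdeal) :
    Nat.card (toricLocalCondition (W.baseChange K) (v.adicCompletion K) ((p ^ 1 : ℕ) : ℤ)) = p := by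
  have hp : p.Prime := Fact.out
  haveI : NeZero (p ^ 1 : ℕ) := ⟨pow_ne_zero 1 hp.ne_zero⟩
  haveI : IsTotallyComplex K := hK.2
  haveI : Finite (geomTorsion (W.baseChange K) ((p ^ 1 : ℕ) : ℤ)) := finite_geomTorsion_of_neZero (W.baseChange K) (p ^ 1)
  obtain ⟨e, hμ, hadd₁, hadd₂, halt, hnondeg, hgal⟩ :=
    exists_weilPairing_holds (W.baseChange K) (p ^ 1) (by rw [pow_one]; exact hp.two_le) (by
      exact_mod_cast pow_ne_zero 1 hp.ne_zero)
  obtain ⟨inv, hperf, -⟩ := poitouTate_sum_localTatePairing_eq_zero_of_isTotallyComplex K (p ^ 1)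
  have hmax := annRight_invWeilPairing_eq_of_isotropic_of_card_le (W.baseChange K) (p ^ 1) e hμ hadd₁ hadd₂ hgal
    hnondeg inv v (hperf v).1.1 (toricLocalCondition (W.baseChange K) (v.adicCompletion K) ((p ^ 1 : ℕ) : ℤ))
    (fun a ha a' ha' ↦ htorIso_toricLocalCondition W K p hK.1 q v hqv e hμ hadd₁ hadd₂ halt hgal a ha a' ha')
    (natCard_galoisCohomology_one_le_mul_natCard_toricLocalCondition W K p hK.1 q v hqv)
  have h := natCard_mul_self_eq_of_annRight_eq W K p e hμ hadd₁ hadd₂ hnondeg hgal inv v (hperf v).1.1 _ hmax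
  rw [natCard_localH1_eq_sq_of_admQ W K p hK.1 q v hqv, sq] at h
  exact Nat.mul_self_inj.mp h

end Local

/-! ## §3 Poitou–Tate at two places: the `{v₁, v₂}`-relaxed Kummer group has Lagrangian image -/

section TwoPlaces

variable (W : WeierstrassCurve ℚ) (K : Type) [Field K] [NumberField K] (p : ℕ) [W.IsElliptic] [Fact p.Prime]
variable (e : geomTorsion (W.baseChange K) ((p ^ 1 : ℕ) : ℤ) → geomTorsion (W.baseChange K) ((p ^ 1 : ℕ) : ℤ) →
    AlgebraicClosure K)
  (hμ : ∀ P Q, e P Q ^ (p ^ 1) = 1) (hadd₁ : ∀ P₁ P₂ Q, e (P₁ + P₂) Q = e P₁ Q * e P₂ Q)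
  (hadd₂ : ∀ P Q₁ Q₂, e P (Q₁ + Q₂) = e P Q₁ * e P Q₂) (halt : ∀ Q, e Q Q = 1)
  (hnondeg : ∀ Q, (∀ P, e P Q = 1) → Q = 0)
  (hgal : ∀ (σ : absoluteGaloisGroup K) (P Q : geomTorsion (W.baseChange K) ((p ^ 1 : ℕ) : ℤ)),
    σ • e P Q = e (σ • P) (σ • Q))
  (inv : LocalInvariants K (p ^ 1))

include halt hnondeg in
/-- **THE `{v₁, v₂}`-RELAXED KUMMER GROUP HAS LAGRANGIAN IMAGE** (`K` imaginary quadratic, `inv` a Poitou–Tate family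
at level `p`). For finite places `v₁ ≠ v₂` let `Λ ≤ H¹(K_{v₁}, E[p]) × H¹(K_{v₂}, E[p])` be the image of
`kummerOutside E p {v₁, v₂}` under `(loc_{v₁}, loc_{v₂})`. Then (isotropy) `b₁(l₁, l′₁) + b₂(l₂, l′₂) = 0` on `Λ`
(Poitou–Tate vanishing + Kummer isotropy off `v₁, v₂`) and (maximality) every `t` with `b₁(l₁, t₁) + b₂(l₂, t₂) = 0`
for all `l ∈ Λ` lies in `Λ` (Howard Thm. 2.1.11 for `kummerStrict ≤ kummerRelaxed`, X11b
`exists_mem_kummerOutside_localization_eq`, after symmetrising). [cite: MilneADT2006, Ch. I, Thm. 4.10]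
[cite: Howard2004HeegnerKolyvagin, Thm. 2.1.11] -/
theorem lagrangian_image_kummerOutside_pair
    [∀ v : Place K, CompactSpace (absoluteGaloisGroup (Place.Completion v))]
    [Finite (geomTorsion (W.baseChange K) ((p ^ 1 : ℕ) : ℤ))]
    (hK : IsImaginaryQuadratic K) (hperf : inv.IsPerfect)
    (hsum : inv.SumLocalTermEqZero) (hcompl : inv.SelmerComplement)
    (v₁ v₂ : HeightOneSpectrum (𝓞 K)) (hne : v₁ ≠ v₂) :
    let Λ := (kummerOutside (W.baseChange K) (p ^ 1) ({Sum.inr v₁, Sum.inr v₂} : Finset (Place K))).map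
      ((galoisCohomology.localization ((W.baseChange K).torsionGaloisModule ((p ^ 1 : ℕ) : ℤ)) (Sum.inr v₁) 1).prod
        (galoisCohomology.localization ((W.baseChange K).torsionGaloisModule ((p ^ 1 : ℕ) : ℤ)) (Sum.inr v₂) 1))
    (∀ l ∈ Λ, ∀ l' ∈ Λ,
        invWeilPairing (W.baseChange K) (p ^ 1) e hμ hadd₁ hadd₂ hgal inv (Sum.inr v₁) l.1 l'.1 +
          invWeilPairing (W.baseChange K) (p ^ 1) e hμ hadd₁ hadd₂ hgal inv (Sum.inr v₂) l.2 l'.2 = 0) ∧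
      (∀ t, (∀ l ∈ Λ,
        invWeilPairing (W.baseChange K) (p ^ 1) e hμ hadd₁ hadd₂ hgal inv (Sum.inr v₁) l.1 t.1 +
          invWeilPairing (W.baseChange K) (p ^ 1) e hμ hadd₁ hadd₂ hgal inv (Sum.inr v₂) l.2 t.2 = 0) → t ∈ Λ) := by
  intro Λ
  have hp : p.Prime := Fact.out
  haveI : NeZero (p ^ 1 : ℕ) := ⟨pow_ne_zero 1 hp.ne_zero⟩
  have hne' : (Sum.inr v₁ : Place K) ≠ Sum.inr v₂ := fun h ↦ hne (Sum.inr_injective h)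
  set S' : Finset (Place K) := {Sum.inr v₁, Sum.inr v₂} with hS'
  set loc₁ := galoisCohomology.localization ((W.baseChange K).torsionGaloisModule ((p ^ 1 : ℕ) : ℤ)) (Sum.inr v₁) 1
    with hloc₁
  set loc₂ := galoisCohomology.localization ((W.baseChange K).torsionGaloisModule ((p ^ 1 : ℕ) : ℤ)) (Sum.inr v₂) 1
    with hloc₂
  -- the Poitou–Tate sum over `S' = {v₁, v₂}` is the two-term sum
  have hsum2 : ∀ (f : Place K → ZMod (p ^ 1)), ∑ v ∈ S', f v = f (Sum.inr v₁) + f (Sum.inr v₂) := fun f ↦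
    Finset.sum_pair hne'
  refine ⟨?_, ?_⟩
  · rintro _ ⟨y, hy, rfl⟩ _ ⟨z, hz, rfl⟩
    have h := KummerPT.sum_invWeilPairing_localization_eq_zero_of_mem_kummerOutside (W.baseChange K) (p ^ 1) e hμ
      hadd₁ hadd₂ hgal halt inv hsum S' hy hz
    rw [hsum2] at h
    exact h
  · intro t ht
    have hp1 : IsPrimePow (p ^ 1 : ℕ) := hp.isPrimePow.pow one_ne_zero
    have hEuler : ∀ v : HeightOneSpectrum (𝓞 K),
        Nat.card (galoisCohomology (((W.baseChange K).torsionGaloisModule ((p ^ 1 : ℕ) : ℤ)).toLocal (Sum.inr v)) 1) =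
          (Nat.card (nsmulAddMonoidHom (p ^ 1) :
              ((W.baseChange K).baseChange (v.adicCompletion K)).toAffine.Point →+ _).ker *
            Nat.card (v.adicCompletionIntegers K ⧸
              Ideal.span {((p ^ 1 : ℕ) : v.adicCompletionIntegers K)})) ^ 2 := fun v ↦ by
      haveI : CharZero (v.adicCompletion K) := charZero_of_injective_algebraMap (algebraMap K _).injective
      exact natCard_galoisCohomology_one_torsion_adicCompletion_eq_sq (W.baseChange K) v (p ^ 1) hp1
        (localEulerPoincareCharacteristic_holds (v.adicCompletion K))
    -- the test family: `t` at `v₁, v₂`, zero elsewhere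
    let t' : Π v : Place K, galoisCohomology (((W.baseChange K).torsionGaloisModule ((p ^ 1 : ℕ) : ℤ)).toLocal v) 1 :=
      fun v ↦ if h₁ : v = Sum.inr v₁ then h₁ ▸ t.1 else if h₂ : v = Sum.inr v₂ then h₂ ▸ t.2 else 0
    have ht'₁ : t' (Sum.inr v₁) = t.1 := by simp [t']
    have ht'₂ : t' (Sum.inr v₂) = t.2 := by simp [t', hne'.symm]
    obtain ⟨x, hx, hxt⟩ := KummerPT.exists_mem_kummerOutside_localization_eq (W.baseChange K) p 1 e hμ hadd₁ hadd₂ hgal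
      halt hnondeg (fun w ↦ hK.2.isComplex w) hperf hcompl hEuler S' t' (fun c hc ↦ by
        rw [hsum2, ht'₁, ht'₂]
        -- symmetrise: `b(t_i, loc c) = b(loc c, t_i)`
        rw [invWeilPairing_symm_P W K p e hμ hadd₁ hadd₂ halt hgal inv (Sum.inr v₁),
          invWeilPairing_symm_P W K p e hμ hadd₁ hadd₂ halt hgal inv (Sum.inr v₂)]
        exact ht (loc₁ c, loc₂ c) ⟨c, hc, rfl⟩)
    refine ⟨x, hx, Prod.ext ?_ ?_⟩
    · have h := hxt (Sum.inr v₁) (by simp [hS'])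
      rw [ht'₁] at h
      exact h
    · have h := hxt (Sum.inr v₂) (by simp [hS'])
      rw [ht'₂] at h
      exact h

/-- **`#Λ = p²` at two admissible places**: the Lagrangian image of the `{v₁, v₂}`-relaxed Kummer group in the
orthogonal sum of the two planes `H¹(K_{v_i}, E[p])` of order `p²` has `p²` elements (§1 + §2; a Weil pairing exists by
the tree's PROVED `exists_weilPairing_holds`). [cite: WZhang2014, Lemma 5.3] [cite: MilneADT2006, Ch. I, Thm. 4.10] -/
theorem natCard_image_kummerOutside_pair [W.IsGloballyMinimal]
    [∀ v : Place K, CompactSpace (absoluteGaloisGroup (Place.Completion v))]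
    (hK : IsImaginaryQuadratic K) (hperf : inv.IsPerfect)
    (hsum : inv.SumLocalTermEqZero) (hcompl : inv.SelmerComplement)
    (q₁ q₂ : AdmQ W K p) (v₁ v₂ : HeightOneSpectrum (𝓞 K)) (hne : v₁ ≠ v₂)
    (hv₁ : ((q₁ : ℕ) : 𝓞 K) ∈ v₁.asIdeal) (hv₂ : ((q₂ : ℕ) : 𝓞 K) ∈ v₂.asIdeal) :
    Nat.card ((kummerOutside (W.baseChange K) (p ^ 1) ({Sum.inr v₁, Sum.inr v₂} : Finset (Place K))).map
      ((galoisCohomology.localization ((W.baseChange K).torsionGaloisModule ((p ^ 1 : ℕ) : ℤ)) (Sum.inr v₁) 1).prod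
        (galoisCohomology.localization ((W.baseChange K).torsionGaloisModule ((p ^ 1 : ℕ) : ℤ)) (Sum.inr v₂) 1))) =
      p ^ 2 := by
  have hp : p.Prime := Fact.out
  haveI : NeZero (p ^ 1 : ℕ) := ⟨pow_ne_zero 1 hp.ne_zero⟩
  haveI : Finite (geomTorsion (W.baseChange K) ((p ^ 1 : ℕ) : ℤ)) := finite_geomTorsion_of_neZero (W.baseChange K) (p ^ 1)
  haveI := KummerPT.finite_galoisCohomology_toLocal_inr (W.baseChange K) (p ^ 1) v₁
  haveI := KummerPT.finite_galoisCohomology_toLocal_inr (W.baseChange K) (p ^ 1) v₂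
  obtain ⟨e, hμ, hadd₁, hadd₂, halt, hnondeg, hgal⟩ :=
    exists_weilPairing_holds (W.baseChange K) (p ^ 1) (by rw [pow_one]; exact hp.two_le) (by
      exact_mod_cast pow_ne_zero 1 hp.ne_zero)
  obtain ⟨hiso, hmax⟩ := lagrangian_image_kummerOutside_pair W K p e hμ hadd₁ hadd₂ halt hnondeg hgal inv hK hperf
    hsum hcompl v₁ v₂ hne
  have h := natCard_mul_self_eq_of_lagrangian_prod
    (KummerPT.nsmul_galoisCohomology_toLocal_eq_zero (W.baseChange K) (p ^ 1) (Sum.inr v₁))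
    (KummerPT.nsmul_galoisCohomology_toLocal_eq_zero (W.baseChange K) (p ^ 1) (Sum.inr v₂))
    _ _ (KummerPT.invWeilPairing_flip_bijective (W.baseChange K) (p ^ 1) e hμ hadd₁ hadd₂ hgal hnondeg inv v₁
      (hperf v₁).1.1).1
    (KummerPT.invWeilPairing_flip_bijective (W.baseChange K) (p ^ 1) e hμ hadd₁ hadd₂ hgal hnondeg inv v₂
      (hperf v₂).1.1).1 _ hiso hmax
  rw [natCard_localH1_eq_sq_of_admQ W K p hK.1 q₁ v₁ hv₁, natCard_localH1_eq_sq_of_admQ W K p hK.1 q₂ v₂ hv₂,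
    ← sq, ← mul_pow] at h
  have h' := (Nat.pow_left_injective two_ne_zero) h
  rw [h', sq]

end TwoPlaces

end Summit.BirchSwinnertonDyer.BirchSwinnertonDyer.Theorems.AdditiveKoly

end
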